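import Mathlib
import HarnessLib
import Summits.Ventures.LatticeQCDFlow.Scaling.AutoregressiveGaugePlaquetteReads

/-!
# LatticeQCDFlow / Scaling — USEFUL CONTEXT MUST TOUCH BOTH ENDPOINTS: a conditional for a gauge link that
# ignores every other retained link at one of its endpoints is no better than the flat (Haar) conditional,
# for every convex loss (Wilson-weighted `L¹`, training loss), every compact gauge group, every dimension

HONEST FRAMING: exact (Metropolis-corrected) sampling algorithms for lattice gauge theory;
figures of merit are autocorrelation/cost numbers at stated couplings and volumes; no
continuum-physics claim.

Venture `LatticeQCDFlow` (cell pub-lqcd), topic `Scaling`, FANOUT row 30 (lean-1, GEN-18) — OUR WORK for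
THEORY-2 §4 row C5 (gauge case); the vertex (star-free) form of `Scaling/AutoregressiveGaugeBlindProposal`,
`…ProposalAveraging`, `…ProposalEntropy`.  Any `d`, `L`, compact group `G` (Haar probability `μ`,
`π = μ^{⊗E}`), bounded measurable gauge-invariant weight `F`, ANY two sets `s, s'` of integrated links
(`N = A_s F`, `M = A_{s'} F`; e.g. `s' = insert a s`, when `N/M` is the exact autoregressive conditional density
of `U_a`), a link `a` that is not a loop, one of its endpoints `y`, and a bounded measurable "proposal
density" `q` that is BLIND TO EVERY LINK AT `y` OTHER THAN `a` (it may read `a` and anything away from `y`).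

* §1 **`integral_convexLoss_avg_le_of_moves`** (abstract; Fubini + Jensen): `π`-preserving moves leaving a
  loss `ψ(U, t)` (convex, continuous in `t`) invariant and acting on `q` through the `a`-coordinate by
  Haar-preserving maps give `∫ ψ(U, q̄ U) dπ ≤ ∫ ψ(U, q U) dπ`, `q̄(U) = ∫ q(U[a ↦ v]) dv`.
* §2 **`eq_of_blind_of_eqOn`**; **`vertex_moves`** — the rotations at `y` (tree `gaugeTransformMEquiv`,
  `isGaugeInvariant_coordAvg`) fix every `A_s F` and act on such a `q` through `U_a ↦ gU_a` / `U_a g⁻¹`.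
* §3 **`integral_abs_sub_avg_le_of_vertexBlind`** (`∫ |N − q̄·M| ≤ ∫ |N − q·M|`),
  **`integral_abs_sub_le_of_vertexBlind`** (`q` normalised in the `a` coordinate ⇒ `∫ |N − M| ≤ ∫ |N − q·M|`:
  no better than Haar in Wilson-weighted `L¹`), **`integral_mul_log_le_avg_of_vertexBlind`**,
  **`integral_mul_log_nonpos_of_vertexBlind`** (`F ≥ 0`, `0 < c ≤ q ≤ C`: `∫ N·log q ≤ ∫ N·log q̄ ≤ 0` — never
  beats the flat conditional in training loss), **`integral_weight_mul_log_nonpos_of_vertexBlind`** (`∫ F·log q ≤ 0`).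

READING (value-free): in an exact autoregressive factorisation of a lattice gauge theory, for EVERY link order
and EVERY position, a conditional for the current link whose context omits all previously sampled links at one
endpoint of that link is worthless (no better than flat): useful context must reach both endpoints.  The corner
statements of the parents are the special cases with one other retained link at `y`.  NOT CLAIMED: anything
about contexts touching both endpoints; any number of ours.  No `def`; nothing cited as a fact; no `sorry`.
-/

noncomputable section

namespace Summit.Ventures.LatticeQCDFlow.Theory2.Autoregressive

open MeasureTheory Function Set
open Literature.MathematicalPhysics.QuantumFieldTheory
open Literature.Barriers.QuantumFields.Elitzur (gaugeTransformMEquiv)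
open Summit.Ventures.LatticeQCDFlow.Exactness

variable {d L : ℕ} {G : Type*} [Group G] [TopologicalSpace G] [IsTopologicalGroup G] [CompactSpace G]
  [SecondCountableTopology G] [MeasurableSpace G] [BorelSpace G] [NeZero L]

/-! ## §1 Averaging a blind proposal never increases a convex loss -/

omit [SecondCountableTopology G] in
/-- **CONVEX-LOSS AVERAGING** (abstract form).  `ψ(U, t)` jointly measurable, convex and continuous in
`t ∈ [lo, hi]`, bounded there; `q` measurable with values in `[lo, hi]`; `π`-preserving moves `T_g` with
`ψ(T_g U, ·) = ψ(U, ·)` acting on `q` through the `a`-coordinate, `q(T_g U) = q(U[a ↦ c_g(U_a)])`, each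
`g ↦ c_g(v)` pushing Haar to Haar.  Then `∫ ψ(U, q̄ U) dπ ≤ ∫ ψ(U, q U) dπ`, `q̄(U) = ∫ q(U[a ↦ v]) dv`. [ours] -/
theorem integral_convexLoss_avg_le_of_moves (a : Edge d L) (ψ : GaugeConfig d L G → ℝ → ℝ)
    {lo hi : ℝ} (hψm : Measurable (uncurry ψ)) (hconv : ∀ U, ConvexOn ℝ (Icc lo hi) (ψ U))
    (hcont : ∀ U, ContinuousOn (ψ U) (Icc lo hi)) (hψb : ∃ B, ∀ U t, t ∈ Icc lo hi → |ψ U t| ≤ B)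
    {q : GaugeConfig d L G → ℝ} (hqm : Measurable q) (hqlo : ∀ U, lo ≤ q U) (hqhi : ∀ U, q U ≤ hi)
    (T : G → (GaugeConfig d L G ≃ᵐ GaugeConfig d L G))
    (hTmp : ∀ g, MeasurePreserving (T g) (Measure.pi fun _ : Edge d L => haarProbability G)
      (Measure.pi fun _ : Edge d L => haarProbability G))
    (hψT : ∀ g U t, ψ (T g U) t = ψ U t)
    (c : G → G → G) (hc : Measurable (uncurry c))
    (hcmp : ∀ v : G, MeasurePreserving (fun g => c g v) (haarProbability G) (haarProbability G))
    (hqT : ∀ g U, q (T g U) = q (update U a (c g (U a)))) :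
    ∫ U, ψ U (∫ v, q (update U a v) ∂(haarProbability G)) ∂Measure.pi (fun _ : Edge d L => haarProbability G) ≤
      ∫ U, ψ U (q U) ∂Measure.pi (fun _ : Edge d L => haarProbability G) := by
  classical
  set μ := haarProbability G with hμ
  set π := Measure.pi (fun _ : Edge d L => μ) with hπ
  obtain ⟨B, hB⟩ := hψb
  have hqI : ∀ U, q U ∈ Icc lo hi := fun U => ⟨hqlo U, hqhi U⟩
  have hqabs : ∀ U, |q U| ≤ |lo| + |hi| := fun U => by
    rw [abs_le]; constructor
    · linarith [hqlo U, neg_abs_le lo, abs_nonneg hi]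
    · linarith [hqhi U, le_abs_self hi, abs_nonneg lo]
  have hψUm : ∀ U, Measurable (ψ U) := fun U => hψm.comp (measurable_const.prodMk measurable_id)
  set φ : G → GaugeConfig d L G → ℝ := fun g U => ψ U (q (update U a (c g (U a)))) with hφ
  -- Step 1: for every `g` the integral is unchanged by the move
  have hstep1 : ∀ g : G, ∫ U, ψ U (q U) ∂π = ∫ U, φ g U ∂π := by
    intro g
    have h := (hTmp g).integral_comp' (fun U => ψ U (q U))
    rw [← h]
    refine integral_congr_ae (ae_of_all _ fun U => ?_)
    show ψ (T g U) (q (T g U)) = ψ U (q (update U a (c g (U a))))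
    rw [hψT, hqT]
  have hupd : Measurable fun p : G × GaugeConfig d L G => update p.2 a (c p.1 (p.2 a)) := by
    refine measurable_pi_lambda _ fun e => ?_
    by_cases he : e = a
    · subst he
      simp only [update_self]
      exact hc.comp (measurable_fst.prodMk ((measurable_pi_apply _).comp measurable_snd))
    · simp only [update_of_ne he]
      exact (measurable_pi_apply e).comp measurable_snd
  have hqum : Measurable fun p : G × GaugeConfig d L G => q (update p.2 a (c p.1 (p.2 a))) :=
    hqm.comp hupd
  have hφm : Measurable (uncurry φ) := hψm.comp (measurable_snd.prodMk hqum)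
  have hφb : ∀ g U, |φ g U| ≤ B := fun g U => hB U _ (hqI _)
  have hφi : Integrable (uncurry φ) (μ.prod π) :=
    Integrable.mono' (integrable_const _) hφm.aestronglyMeasurable
      (ae_of_all _ fun p => by rw [Real.norm_eq_abs]; exact hφb p.1 p.2)
  -- Step 2: average over `g` and swap the integrals
  have hstep2 : ∫ U, ψ U (q U) ∂π = ∫ U, ∫ g, φ g U ∂μ ∂π := by
    have hconst : ∫ g, (∫ U, ψ U (q U) ∂π) ∂μ = ∫ U, ψ U (q U) ∂π := by
      rw [integral_const, Measure.real, measure_univ, ENNReal.toReal_one, one_smul]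
    rw [← hconst, integral_congr_ae (ae_of_all _ fun g => hstep1 g)]
    exact integral_integral_swap hφi
  -- Step 3: `∫_G q(U[a ↦ c_g(U_a)]) dg = q̄(U)`, and Jensen
  have hqvm : ∀ U : GaugeConfig d L G, Measurable fun v => q (update U a v) :=
    fun U => hqm.comp (measurable_update U)
  have havg : ∀ U : GaugeConfig d L G, ∫ g, q (update U a (c g (U a))) ∂μ = ∫ v, q (update U a v) ∂μ := by
    intro U
    have h := integral_map (hcmp (U a)).measurable.aemeasurable (hqvm U).aestronglyMeasurable
      (μ := μ) (φ := fun g => c g (U a))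
    rw [(hcmp (U a)).map_eq] at h
    exact h.symm
  have hgm : ∀ U : GaugeConfig d L G, Measurable fun g : G => q (update U a (c g (U a))) :=
    fun U => hqum.comp (measurable_id.prodMk measurable_const)
  have hinner : ∀ U : GaugeConfig d L G, ψ U (∫ v, q (update U a v) ∂μ) ≤ ∫ g, φ g U ∂μ := by
    intro U
    rw [← havg U]
    have hfi : Integrable (fun g : G => q (update U a (c g (U a)))) μ :=
      Integrable.mono' (integrable_const (|lo| + |hi|)) (hgm U).aestronglyMeasurable
        (ae_of_all _ fun g => by rw [Real.norm_eq_abs]; exact hqabs _)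
    have hgi : Integrable (ψ U ∘ fun g : G => q (update U a (c g (U a)))) μ :=
      Integrable.mono' (integrable_const B) ((hψUm U).comp (hgm U)).aestronglyMeasurable
        (ae_of_all _ fun g => by rw [Real.norm_eq_abs]; exact hB U _ (hqI _))
    exact (hconv U).map_integral_le (hcont U) isClosed_Icc (ae_of_all _ fun g => hqI _) hfi hgi
  -- Step 4: integrate (`q̄ ∈ [lo, hi]` keeps the left side integrable)
  have hqbm : Measurable fun U : GaugeConfig d L G => ∫ v, q (update U a v) ∂μ := by
    have hm : Measurable fun p : GaugeConfig d L G × G => q (update p.1 a p.2) :=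
      hqm.comp (measurable_pi_lambda _ fun e => by
        by_cases he : e = a
        · subst he; simp only [update_self]; exact measurable_snd
        · simp only [update_of_ne he]; exact (measurable_pi_apply e).comp measurable_fst)
    exact (hm.stronglyMeasurable.integral_prod_right' (ν := μ)).measurable
  have hqbI : ∀ U : GaugeConfig d L G, (∫ v, q (update U a v) ∂μ) ∈ Icc lo hi := by
    intro U
    have hqi : Integrable (fun v => q (update U a v)) μ :=
      Integrable.mono' (integrable_const (|lo| + |hi|)) (hqvm U).aestronglyMeasurable
        (ae_of_all _ fun v => by rw [Real.norm_eq_abs]; exact hqabs _)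
    have h1 := integral_mono (integrable_const lo) hqi (fun v => hqlo (update U a v))
    have h2 := integral_mono hqi (integrable_const hi) (fun v => hqhi (update U a v))
    simp only [integral_const, Measure.real, measure_univ, ENNReal.toReal_one, one_smul] at h1 h2
    exact ⟨h1, h2⟩
  have hli : Integrable (fun U => ψ U (∫ v, q (update U a v) ∂μ)) π :=
    Integrable.mono' (integrable_const B) (hψm.comp (measurable_id.prodMk hqbm)).aestronglyMeasurable
      (ae_of_all _ fun U => by rw [Real.norm_eq_abs]; exact hB U _ (hqbI U))
  have hri : Integrable (fun U => ∫ g, φ g U ∂μ) π := MeasureTheory.Integrable.integral_prod_right hφi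
  rw [hstep2]
  exact integral_mono hli hri hinner

/-! ## §2 Blindness to a set of links; the rotations at a vertex -/

omit [Group G] [TopologicalSpace G] [IsTopologicalGroup G] [CompactSpace G] [SecondCountableTopology G]
  [MeasurableSpace G] [BorelSpace G] [NeZero L] in
/-- A function blind to each link of `B` separately takes equal values on configurations agreeing off `B`.
[ours] -/
theorem eq_of_blind_of_eqOn {α : Type*} {q : GaugeConfig d L G → α} (B : Finset (Edge d L))
    (hq : ∀ b ∈ B, ∀ (U : GaugeConfig d L G) (v : G), q (update U b v) = q U)
    {U U' : GaugeConfig d L G} (hUU' : ∀ e, e ∉ B → U e = U' e) : q U = q U' := by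
  classical
  induction B using Finset.induction_on generalizing U' with
  | empty => exact congrArg q (funext fun e => hUU' e (Finset.notMem_empty e))
  | @insert b B hb ih =>
    have h1 : q U = q (update U' b (U b)) := by
      refine ih (fun b' hb' => hq b' (Finset.mem_insert_of_mem hb')) fun e he => ?_
      by_cases heb : e = b
      · subst heb; rw [update_self]
      · rw [update_of_ne heb]; exact hUU' e (by simp [heb, he])
    rw [h1]
    exact hq b (Finset.mem_insert_self b B) U' (U b)

/-- **The rotations at a vertex `y`** as moves: for gauge-invariant `F`, a non-loop link `a` at `y`, and `q`
blind to every other link at `y`, the gauge transformations `U ↦ U^{g at y}` preserve `π` and every `A_s F`, and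
act on `q` through `U_a ↦ g·U_a` (if `a` leaves `y`) or `U_a ↦ U_a·g⁻¹` (if `a` arrives at `y`), both of which
push Haar to Haar in `g`. [ours] -/
theorem vertex_moves {F : GaugeConfig d L G → ℝ} (hF : IsGaugeInvariant F) {y : Site d L} {a : Edge d L}
    (hy : a.1 = y ∨ a.1.shift a.2 = y) (hloop : a.1 ≠ a.1.shift a.2)
    {q : GaugeConfig d L G → ℝ}
    (hqB : ∀ e : Edge d L, e.1 = y ∨ e.1.shift e.2 = y → e ≠ a → ∀ (U : GaugeConfig d L G) (v : G),
      q (update U e v) = q U) :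
    ∃ (T : G → (GaugeConfig d L G ≃ᵐ GaugeConfig d L G)) (c : G → G → G),
      (∀ g, MeasurePreserving (T g) (Measure.pi fun _ : Edge d L => haarProbability G)
        (Measure.pi fun _ : Edge d L => haarProbability G)) ∧
      (∀ (s : Finset (Edge d L)) g U, coordAvg (haarProbability G) s F (T g U) = coordAvg (haarProbability G) s F U) ∧
      Measurable (uncurry c) ∧
      (∀ v : G, MeasurePreserving (fun g => c g v) (haarProbability G) (haarProbability G)) ∧
      ∀ g U, q (T g U) = q (update U a (c g (U a))) := by
  classical
  set μ := haarProbability G with hμ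
  set B : Finset (Edge d L) := Finset.univ.filter fun e => (e.1 = y ∨ e.1.shift e.2 = y) ∧ e ≠ a with hB
  have hqB' : ∀ b ∈ B, ∀ (U : GaugeConfig d L G) (v : G), q (update U b v) = q U := by
    intro b hb
    simp only [hB, Finset.mem_filter, Finset.mem_univ, true_and] at hb
    exact hqB b hb.1 hb.2
  have hT : ∀ g : G, (gaugeTransformMEquiv (d := d) (L := L) (Pi.mulSingle y g) :
      GaugeConfig d L G → GaugeConfig d L G) = gaugeTransform (Pi.mulSingle y g) := fun g => rfl
  refine ⟨fun g => gaugeTransformMEquiv (Pi.mulSingle y g),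
    fun g v => if a.1 = y then g * v else v * g⁻¹, fun g => ?_, fun s g U => ?_, ?_, fun v => ?_,
    fun g U => ?_⟩
  · rw [hT]; exact Literature.Barriers.QuantumFields.Elitzur.measurePreserving_gaugeTransform _
  · rw [hT]; exact isGaugeInvariant_coordAvg s hF _ U
  · by_cases h : a.1 = y
    · simp only [h, if_true]; exact measurable_fst.mul measurable_snd
    · simp only [h, if_false]; exact measurable_snd.mul measurable_fst.inv
  · by_cases h : a.1 = y
    · simp only [h, if_true]; exact measurePreserving_mul_right μ v
    · simp only [h, if_false]
      exact (measurePreserving_mul_left μ v).comp (Measure.measurePreserving_inv μ)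
  · rw [hT]
    refine eq_of_blind_of_eqOn B hqB' fun e he => ?_
    have he' : ¬ ((e.1 = y ∨ e.1.shift e.2 = y) ∧ e ≠ a) := by
      simpa [hB, Finset.mem_filter] using he
    by_cases hea : e = a
    · subst hea
      rw [update_self]
      by_cases h : e.1 = y
      · simp only [h, if_true]
        exact gaugeTransform_mulSingle_apply_of_fst_eq g U h (fun h' => hloop (h.trans h'.symm))
      · simp only [h, if_false]
        exact gaugeTransform_mulSingle_apply_of_shift_eq g U h (hy.resolve_left h)
    · rw [update_of_ne hea]
      have hni : ¬ (e.1 = y ∨ e.1.shift e.2 = y) := fun hi => he' ⟨hi, hea⟩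
      exact gaugeTransform_mulSingle_apply_of_not_incident y g U (fun h1 => hni (Or.inl h1))
        (fun h2 => hni (Or.inr h2))

/-! ## §3 Vertex-blind proposals are no better than Haar -/

/-- **`L¹` form, averaging**: for `q` blind to every link at `y` other than `a`,
`∫ |A_s F − q̄·A_{s'} F| dπ ≤ ∫ |A_s F − q·A_{s'} F| dπ`, `q̄` the Haar average of `q` over `a`. [ours] -/
theorem integral_abs_sub_avg_le_of_vertexBlind (s s' : Finset (Edge d L))
    {F : GaugeConfig d L G → ℝ} (hF : IsGaugeInvariant F) (hFm : Measurable F) (hFb : ∃ C, ∀ U, |F U| ≤ C)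
    {y : Site d L} {a : Edge d L} (hy : a.1 = y ∨ a.1.shift a.2 = y) (hloop : a.1 ≠ a.1.shift a.2)
    {q : GaugeConfig d L G → ℝ} (hqm : Measurable q) (hqb : ∃ C, ∀ U, |q U| ≤ C)
    (hqB : ∀ e : Edge d L, e.1 = y ∨ e.1.shift e.2 = y → e ≠ a → ∀ (U : GaugeConfig d L G) (v : G),
      q (update U e v) = q U) :
    ∫ U, |coordAvg (haarProbability G) s F U -
          (∫ v, q (update U a v) ∂(haarProbability G)) * coordAvg (haarProbability G) s' F U|
        ∂Measure.pi (fun _ : Edge d L => haarProbability G) ≤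
      ∫ U, |coordAvg (haarProbability G) s F U - q U * coordAvg (haarProbability G) s' F U|
        ∂Measure.pi (fun _ : Edge d L => haarProbability G) := by
  classical
  set μ := haarProbability G with hμ
  set N := coordAvg μ s F with hN
  set M := coordAvg μ s' F with hM
  obtain ⟨CF, hCF⟩ := hFb
  obtain ⟨Cq, hCq⟩ := hqb
  have hFlo : ∀ U, -CF ≤ F U := fun U => (abs_le.1 (hCF U)).1
  have hFhi : ∀ U, F U ≤ CF := fun U => (abs_le.1 (hCF U)).2
  have hNb : ∀ U, |N U| ≤ CF := fun U => abs_le.2 (coordAvg_mem_Icc μ s hFm hFlo hFhi U)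
  have hMb : ∀ U, |M U| ≤ CF := fun U => abs_le.2 (coordAvg_mem_Icc μ s' hFm hFlo hFhi U)
  have hNm : Measurable N := measurable_coordAvg μ s hFm
  have hMm : Measurable M := measurable_coordAvg μ s' hFm
  have hCq0 : 0 ≤ Cq := (abs_nonneg _).trans (hCq 1)
  obtain ⟨T, c, hTmp, hTN, hc, hcmp, hqT⟩ := vertex_moves (G := G) hF hy hloop hqB
  refine integral_convexLoss_avg_le_of_moves a (fun U t => |N U - t * M U|) (lo := -Cq) (hi := Cq)
    ((hNm.comp measurable_fst).sub (measurable_snd.mul (hMm.comp measurable_fst))).abs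
    (fun U => ?_) (fun U => ?_) ⟨CF + Cq * CF, fun U t ht => ?_⟩ hqm
    (fun U => (abs_le.1 (hCq U)).1) (fun U => (abs_le.1 (hCq U)).2) T hTmp (fun g U t => ?_) c hc hcmp hqT
  · refine ⟨convex_Icc _ _, fun x _ z _ p r hp hr hpr => ?_⟩
    simp only [smul_eq_mul]
    have hsplit : N U - (p * x + r * z) * M U = p * (N U - x * M U) + r * (N U - z * M U) := by
      have : p * (N U - x * M U) + r * (N U - z * M U) = (p + r) * N U - (p * x + r * z) * M U := by ring
      rw [this, hpr, one_mul]
    rw [hsplit]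
    calc |p * (N U - x * M U) + r * (N U - z * M U)|
        ≤ |p * (N U - x * M U)| + |r * (N U - z * M U)| := abs_add_le _ _
      _ = p * |N U - x * M U| + r * |N U - z * M U| := by
          rw [abs_mul, abs_mul, abs_of_nonneg hp, abs_of_nonneg hr]
  · exact ((continuous_const.sub (continuous_id.mul continuous_const)).abs).continuousOn
  · rw [abs_abs]
    calc |N U - t * M U| ≤ |N U| + |t * M U| := abs_sub _ _
      _ ≤ CF + Cq * CF := by
          rw [abs_mul]; exact add_le_add (hNb U) (mul_le_mul (abs_le.2 ht) (hMb U) (abs_nonneg _) hCq0)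
  · show |N (T g U) - t * M (T g U)| = |N U - t * M U|
    simp only [hN, hM, hμ, hTN]

/-- **`L¹` FORM — NO BETTER THAN HAAR**: if moreover `q` is a probability density in the `a` coordinate then
`∫ |A_s F − A_{s'} F| dπ ≤ ∫ |A_s F − q·A_{s'} F| dπ`; with `s' = insert a s` the left side is the error of the
flat Haar proposal for `U_a`. [ours] -/
theorem integral_abs_sub_le_of_vertexBlind (s s' : Finset (Edge d L))
    {F : GaugeConfig d L G → ℝ} (hF : IsGaugeInvariant F) (hFm : Measurable F) (hFb : ∃ C, ∀ U, |F U| ≤ C)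
    {y : Site d L} {a : Edge d L} (hy : a.1 = y ∨ a.1.shift a.2 = y) (hloop : a.1 ≠ a.1.shift a.2)
    {q : GaugeConfig d L G → ℝ} (hqm : Measurable q) (hqb : ∃ C, ∀ U, |q U| ≤ C)
    (hqB : ∀ e : Edge d L, e.1 = y ∨ e.1.shift e.2 = y → e ≠ a → ∀ (U : GaugeConfig d L G) (v : G),
      q (update U e v) = q U)
    (hq₁ : ∀ U, ∫ v, q (update U a v) ∂(haarProbability G) = 1) :
    ∫ U, |coordAvg (haarProbability G) s F U - coordAvg (haarProbability G) s' F U|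
        ∂Measure.pi (fun _ : Edge d L => haarProbability G) ≤
      ∫ U, |coordAvg (haarProbability G) s F U - q U * coordAvg (haarProbability G) s' F U|
        ∂Measure.pi (fun _ : Edge d L => haarProbability G) := by
  have h := integral_abs_sub_avg_le_of_vertexBlind s s' hF hFm hFb hy hloop hqm hqb hqB
  simpa only [hq₁, one_mul] using h

/-- **Log-likelihood form, averaging** (`F ≥ 0`, `0 < c ≤ q ≤ C`): for `q` blind to every link at `y` other than
`a`, `∫ A_s F·log q dπ ≤ ∫ A_s F·log q̄ dπ`. [ours] -/
theorem integral_mul_log_le_avg_of_vertexBlind (s : Finset (Edge d L))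
    {F : GaugeConfig d L G → ℝ} (hF : IsGaugeInvariant F) (hFm : Measurable F) (hF0 : ∀ U, 0 ≤ F U)
    (hFb : ∃ C, ∀ U, F U ≤ C)
    {y : Site d L} {a : Edge d L} (hy : a.1 = y ∨ a.1.shift a.2 = y) (hloop : a.1 ≠ a.1.shift a.2)
    {q : GaugeConfig d L G → ℝ} (hqm : Measurable q) (hqc : ∃ c, 0 < c ∧ ∀ U, c ≤ q U)
    (hqC : ∃ C, ∀ U, q U ≤ C)
    (hqB : ∀ e : Edge d L, e.1 = y ∨ e.1.shift e.2 = y → e ≠ a → ∀ (U : GaugeConfig d L G) (v : G),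
      q (update U e v) = q U) :
    ∫ U, coordAvg (haarProbability G) s F U * Real.log (q U)
        ∂Measure.pi (fun _ : Edge d L => haarProbability G) ≤
      ∫ U, coordAvg (haarProbability G) s F U * Real.log (∫ v, q (update U a v) ∂(haarProbability G))
        ∂Measure.pi (fun _ : Edge d L => haarProbability G) := by
  classical
  set μ := haarProbability G with hμ
  set N := coordAvg μ s F with hN
  obtain ⟨CF, hCF⟩ := hFb
  obtain ⟨c₀, hc₀, hcq⟩ := hqc
  obtain ⟨Cq, hCq⟩ := hqC
  have hN0 : ∀ U, 0 ≤ N U := fun U => (coordAvg_mem_Icc μ s hFm hF0 hCF U).1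
  have hNb : ∀ U, N U ≤ CF := fun U => (coordAvg_mem_Icc μ s hFm hF0 hCF U).2
  have hNm : Measurable N := measurable_coordAvg μ s hFm
  have hCN0 : 0 ≤ CF := (hN0 1).trans (hNb 1)
  set B := |Real.log c₀| + |Real.log Cq| with hB
  have hlogb : ∀ t : ℝ, t ∈ Icc c₀ Cq → |Real.log t| ≤ B := by
    intro t ht
    have h0 : 0 < t := lt_of_lt_of_le hc₀ ht.1
    have hlo : Real.log c₀ ≤ Real.log t := Real.log_le_log hc₀ ht.1
    have hhi : Real.log t ≤ Real.log Cq := Real.log_le_log h0 ht.2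
    rw [abs_le]
    constructor
    · linarith [neg_abs_le (Real.log c₀), abs_nonneg (Real.log Cq)]
    · linarith [le_abs_self (Real.log Cq), abs_nonneg (Real.log c₀)]
  have hconc : ConcaveOn ℝ (Icc c₀ Cq) Real.log :=
    strictConcaveOn_log_Ioi.concaveOn.subset (fun t ht => lt_of_lt_of_le hc₀ ht.1) (convex_Icc c₀ Cq)
  obtain ⟨T, c, hTmp, hTN, hc, hcmp, hqT⟩ := vertex_moves (G := G) hF hy hloop hqB
  have h := integral_convexLoss_avg_le_of_moves a (fun U t => N U * -Real.log t) (lo := c₀) (hi := Cq)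
    ((hNm.comp measurable_fst).mul (Real.measurable_log.comp measurable_snd).neg)
    (fun U => ?_) (fun U => ?_) ⟨CF * B, fun U t ht => ?_⟩ hqm hcq hCq T hTmp (fun g U t => ?_) c hc hcmp hqT
  · simp only [mul_neg, integral_neg, neg_le_neg_iff] at h
    exact h
  · refine ⟨convex_Icc _ _, fun x hx z hz p r hp hr hpr => ?_⟩
    have hj := hconc.2 hx hz hp hr hpr
    simp only [smul_eq_mul] at hj ⊢
    nlinarith [mul_le_mul_of_nonneg_left hj (hN0 U)]
  · exact (continuous_const.continuousOn.mul
      ((Real.continuousOn_log.mono fun t ht => ne_of_gt (lt_of_lt_of_le hc₀ ht.1)).neg))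
  · rw [abs_mul, abs_neg, abs_of_nonneg (hN0 U)]
    exact mul_le_mul (hNb U) (hlogb t ht) (abs_nonneg _) hCN0
  · show N (T g U) * -Real.log t = N U * -Real.log t
    simp only [hN, hμ, hTN]

/-- **LOG-LIKELIHOOD FORM — NEVER BETTER THAN THE FLAT CONDITIONAL**: if moreover `q` is a probability density in
the `a` coordinate then `∫ A_s F·log q dπ ≤ 0 = ∫ A_s F·log 1 dπ`. [ours] -/
theorem integral_mul_log_nonpos_of_vertexBlind (s : Finset (Edge d L))
    {F : GaugeConfig d L G → ℝ} (hF : IsGaugeInvariant F) (hFm : Measurable F) (hF0 : ∀ U, 0 ≤ F U)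
    (hFb : ∃ C, ∀ U, F U ≤ C)
    {y : Site d L} {a : Edge d L} (hy : a.1 = y ∨ a.1.shift a.2 = y) (hloop : a.1 ≠ a.1.shift a.2)
    {q : GaugeConfig d L G → ℝ} (hqm : Measurable q) (hqc : ∃ c, 0 < c ∧ ∀ U, c ≤ q U)
    (hqC : ∃ C, ∀ U, q U ≤ C)
    (hqB : ∀ e : Edge d L, e.1 = y ∨ e.1.shift e.2 = y → e ≠ a → ∀ (U : GaugeConfig d L G) (v : G),
      q (update U e v) = q U)
    (hq₁ : ∀ U, ∫ v, q (update U a v) ∂(haarProbability G) = 1) :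
    ∫ U, coordAvg (haarProbability G) s F U * Real.log (q U)
        ∂Measure.pi (fun _ : Edge d L => haarProbability G) ≤ 0 := by
  have h := integral_mul_log_le_avg_of_vertexBlind s hF hFm hF0 hFb hy hloop hqm hqc hqC hqB
  simpa only [hq₁, Real.log_one, mul_zero, integral_zero] using h

/-- **Under the weight itself** (`q` reads no link of `s`, as every autoregressive conditional does): the expected
log-likelihood of `q` under `F·π` is at most that of the flat conditional, `∫ F·log q dπ ≤ 0` (tower property,
tree `integral_coordAvg_mul_eq`). [ours] -/
theorem integral_weight_mul_log_nonpos_of_vertexBlind (s : Finset (Edge d L))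
    {F : GaugeConfig d L G → ℝ} (hF : IsGaugeInvariant F) (hFm : Measurable F) (hF0 : ∀ U, 0 ≤ F U)
    (hFb : ∃ C, ∀ U, F U ≤ C)
    {y : Site d L} {a : Edge d L} (hy : a.1 = y ∨ a.1.shift a.2 = y) (hloop : a.1 ≠ a.1.shift a.2)
    {q : GaugeConfig d L G → ℝ} (hqm : Measurable q) (hqc : ∃ c, 0 < c ∧ ∀ U, c ≤ q U)
    (hqC : ∃ C, ∀ U, q U ≤ C)
    (hqB : ∀ e : Edge d L, e.1 = y ∨ e.1.shift e.2 = y → e ≠ a → ∀ (U : GaugeConfig d L G) (v : G),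
      q (update U e v) = q U)
    (hq₁ : ∀ U, ∫ v, q (update U a v) ∂(haarProbability G) = 1) (hqs : ∀ U V, q (s.piecewise V U) = q U) :
    ∫ U, F U * Real.log (q U) ∂Measure.pi (fun _ : Edge d L => haarProbability G) ≤ 0 := by
  obtain ⟨c₀, hc₀, hcq⟩ := hqc
  obtain ⟨Cq, hCq⟩ := hqC
  obtain ⟨CF, hCF⟩ := hFb
  have hlogb : ∀ U, |Real.log (q U)| ≤ |Real.log c₀| + |Real.log Cq| := fun U => abs_le.2
    ⟨by linarith [Real.log_le_log hc₀ (hcq U), neg_abs_le (Real.log c₀), abs_nonneg (Real.log Cq)],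
     by linarith [Real.log_le_log (lt_of_lt_of_le hc₀ (hcq U)) (hCq U), le_abs_self (Real.log Cq),
       abs_nonneg (Real.log c₀)]⟩
  rw [integral_coordAvg_mul_eq (haarProbability G) s hFm ⟨CF, fun U => by rw [abs_of_nonneg (hF0 U)]; exact hCF U⟩
    (Φ := fun U => Real.log (q U)) (Real.measurable_log.comp hqm) ⟨_, hlogb⟩
    (fun U V => by show Real.log _ = Real.log _; rw [hqs])]
  exact integral_mul_log_nonpos_of_vertexBlind s hF hFm hF0 ⟨CF, hCF⟩ hy hloop hqm ⟨c₀, hc₀, hcq⟩ ⟨Cq, hCq⟩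
    hqB hq₁

end Summit.Ventures.LatticeQCDFlow.Theory2.Autoregressive

end
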